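import Literature.NumberTheory.EllipticCurves.RankinSelbergStripIntegral
import Literature.Analysis.ODE.RecursiveSeries
import Mathlib.Analysis.SpecialFunctions.Gamma.Basic
import HarnessLib

/-!
# The bilinear strip integral of the Rankin–Selberg method for two `q`-series

Topic `Literature/NumberTheory/EllipticCurves`; namespace
`Literature.NumberTheory.EllipticCurves.ModularForms`. One definition with a body (`qSeries`) and
theorems; no named fact.

For two `q`-series `φ(z) = ∑_{m ≥ 0} a(m) e^{2πimz}`, `F(z) = ∑_{m ≥ 0} b(m) e^{2πimz}` on the upper
half-plane with polynomially bounded coefficients (`|a(m)|, |b(m)| ≤ C (m+1)ᵏ`) and `a(0) = 0`: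

* `intervalIntegral_qSeries_mul_conj` — **Parseval on horizontal lines** (bilinear):
  `∫₀¹ φ(x + it) conj(F(x + it)) dx = ∑_m a(m) conj(b(m)) e^{-4πmt}` (`t > 0`);
* `integral_Ioi_qSeries_mul_conj_mul_cpow` — **the strip integral is a Dirichlet series**: for
  `Re s > 2k`,
  `∫₀^∞ (∫₀¹ φ conj(F) dx) tˢ dt = Γ(s+1) ∑_{m ≥ 1} a(m) conj(b(m)) (4πm)^{-(s+1)}`
  (the term `m = 0` is absent because `a(0) = 0`; both interchanges of sum and integral are
  absolutely convergent).

This is the right-hand side of the Rankin–Selberg unfolding `∫_{Γ\ℍ} φ F̄ Ē(·, s̄) y² dμ =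
2 ∫₀^∞∫₀¹ φ F̄ yˢ dx dy` for a weight-2 cusp form `φ` against a weight-1 form `F` and the weight-one
Eisenstein series (Rankin 1939; Shimura 1976, (2.4); the diagonal case `φ = F` of a cusp form is
the tree's `RankinSelbergStripIntegral.lean`).

## References

* R. A. Rankin, Proc. Cambridge Philos. Soc. 35 (1939), 351–372.
* G. Shimura, *The special values of the zeta functions associated with cusp forms*, Comm. Pure
  Appl. Math. 29 (1976), §2.
-/

noncomputable section

open Complex Real Set MeasureTheory Filter intervalIntegral
open scoped Topology ComplexConjugate

namespace Literature.NumberTheory.EllipticCurves.ModularForms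

/-- A `q`-series `∑_{m ≥ 0} a(m) e^{2πimz}` as a function on `ℂ`. [folklore] -/
def qSeries (a : ℕ → ℂ) (z : ℂ) : ℂ := ∑' m : ℕ, a m * Complex.exp (2 * π * Complex.I * m * z)

/-! ### Terms on a horizontal line -/

/-- `e^{2πim(x + it)} = e^{-2πmt} e^{2πimx}`. [folklore] -/
theorem cexp_horizontal (m : ℕ) (x t : ℝ) :
    Complex.exp (2 * π * Complex.I * m * ((x : ℂ) + t * Complex.I)) =
      ((Real.exp (-(2 * π * m * t)) : ℝ) : ℂ) * Complex.exp (2 * π * Complex.I * m * x) := by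
  rw [Complex.ofReal_exp, ← Complex.exp_add]
  congr 1
  push_cast
  ring_nf
  rw [Complex.I_sq]
  ring

/-- `‖e^{2πimx}‖ = 1`. [folklore] -/
theorem norm_cexp_two_pi_mul (m : ℕ) (x : ℝ) : ‖Complex.exp (2 * π * Complex.I * m * x)‖ = 1 := by
  rw [show (2 * π * Complex.I * m * x : ℂ) = ((2 * π * m * x : ℝ) : ℂ) * Complex.I by push_cast; ring,
    Complex.norm_exp_ofReal_mul_I]

/-- The coefficients times the decay are absolutely summable on a horizontal line:
`∑ ‖a(m)‖ e^{-2πmt} < ∞` (`t > 0`; polynomial times geometric, via the tree's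
`Literature.Analysis.ODE.summable_succ_pow_mul_geometric`). [folklore] -/
theorem summable_norm_mul_exp {a : ℕ → ℂ} {C : ℝ} {k : ℕ} (ha : ∀ m, ‖a m‖ ≤ C * ((m : ℝ) + 1) ^ k)
    {t : ℝ} (ht : 0 < t) : Summable fun m : ℕ ↦ ‖a m‖ * Real.exp (-(2 * π * m * t)) := by
  have hC : 0 ≤ C := by
    have := ha 0
    simp at this
    exact (norm_nonneg _).trans this
  set r : ℝ := Real.exp (-(2 * π * t)) with hr
  have hr0 : 0 ≤ r := (Real.exp_pos _).le
  have hr1 : r < 1 := Real.exp_lt_one_iff.mpr (by nlinarith [Real.pi_pos])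
  have hgeom : ∀ m : ℕ, Real.exp (-(2 * π * m * t)) = r ^ m := by
    intro m
    rw [hr, ← Real.exp_nat_mul]; congr 1; ring
  refine Summable.of_nonneg_of_le (fun m ↦ by positivity) (fun m ↦ ?_)
    ((Literature.Analysis.ODE.summable_succ_pow_mul_geometric k hr0 hr1).mul_left C)
  rw [hgeom]
  calc ‖a m‖ * r ^ m ≤ C * ((m : ℝ) + 1) ^ k * r ^ m :=
        mul_le_mul_of_nonneg_right (ha m) (pow_nonneg hr0 m)
    _ = C * (((m : ℝ) + 1) ^ k * r ^ m) := by ring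

/-- The `q`-series on a horizontal line as an absolutely convergent series:
`φ(x + it) = ∑ a(m) e^{-2πmt} e^{2πimx}`. [folklore] -/
theorem hasSum_qSeries_horizontal {a : ℕ → ℂ} {C : ℝ} {k : ℕ}
    (ha : ∀ m, ‖a m‖ ≤ C * ((m : ℝ) + 1) ^ k) {t : ℝ} (ht : 0 < t) (x : ℝ) :
    HasSum (fun m : ℕ ↦ a m * ((Real.exp (-(2 * π * m * t)) : ℝ) : ℂ) *
      Complex.exp (2 * π * Complex.I * m * x)) (qSeries a ((x : ℂ) + t * Complex.I)) := by
  have hs : Summable fun m : ℕ ↦ a m * ((Real.exp (-(2 * π * m * t)) : ℝ) : ℂ) *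
      Complex.exp (2 * π * Complex.I * m * x) := by
    refine Summable.of_norm ((summable_norm_mul_exp ha ht).congr fun m ↦ ?_)
    rw [norm_mul, norm_mul, norm_cexp_two_pi_mul, mul_one, Complex.norm_real,
      Real.norm_of_nonneg (Real.exp_pos _).le]
  unfold qSeries
  simp_rw [cexp_horizontal, ← mul_assoc]
  exact hs.hasSum

/-! ### Parseval on horizontal lines (bilinear) -/

/-- **Bilinear Parseval on a horizontal line**: for `t > 0`,
`∫₀¹ φ(x + it) conj(F(x + it)) dx = ∑_m a(m) conj(b(m)) e^{-4πmt}`. [folklore] -/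
theorem intervalIntegral_qSeries_mul_conj {a b : ℕ → ℂ} {Ca Cb : ℝ} {k : ℕ}
    (ha : ∀ m, ‖a m‖ ≤ Ca * ((m : ℝ) + 1) ^ k) (hb : ∀ m, ‖b m‖ ≤ Cb * ((m : ℝ) + 1) ^ k)
    {t : ℝ} (ht : 0 < t) :
    ∫ x in (0 : ℝ)..1, qSeries a ((x : ℂ) + t * Complex.I) * conj (qSeries b ((x : ℂ) + t * Complex.I)) =
      ∑' m : ℕ, a m * conj (b m) * ((Real.exp (-(4 * π * m * t)) : ℝ) : ℂ) := by
  -- the two absolutely convergent series on the line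
  set u : ℕ → ℝ → ℂ := fun m x ↦ a m * ((Real.exp (-(2 * π * m * t)) : ℝ) : ℂ) *
    Complex.exp (2 * π * Complex.I * m * x) with hu
  set w : ℕ → ℝ → ℂ := fun m x ↦ conj (b m * ((Real.exp (-(2 * π * m * t)) : ℝ) : ℂ) *
    Complex.exp (2 * π * Complex.I * m * x)) with hw
  have hun : ∀ m x, ‖u m x‖ = ‖a m‖ * Real.exp (-(2 * π * m * t)) := fun m x ↦ by
    simp only [hu, norm_mul, norm_cexp_two_pi_mul, mul_one, Complex.norm_real,
      Real.norm_of_nonneg (Real.exp_pos _).le]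
  have hwn : ∀ m x, ‖w m x‖ = ‖b m‖ * Real.exp (-(2 * π * m * t)) := fun m x ↦ by
    simp only [hw, Complex.norm_conj, norm_mul, norm_cexp_two_pi_mul, mul_one, Complex.norm_real,
      Real.norm_of_nonneg (Real.exp_pos _).le]
  have hus : ∀ x, Summable fun m ↦ ‖u m x‖ := fun x ↦
    (summable_norm_mul_exp ha ht).congr fun m ↦ (hun m x).symm
  have hws : ∀ x, Summable fun m ↦ ‖w m x‖ := fun x ↦
    (summable_norm_mul_exp hb ht).congr fun m ↦ (hwn m x).symm
  -- pointwise: the product is a double series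
  have hprod : ∀ x : ℝ, qSeries a ((x : ℂ) + t * Complex.I) * conj (qSeries b ((x : ℂ) + t * Complex.I)) =
      ∑' p : ℕ × ℕ, u p.1 x * w p.2 x := by
    intro x
    rw [← (hasSum_qSeries_horizontal ha ht x).tsum_eq, ← (hasSum_qSeries_horizontal hb ht x).tsum_eq,
      Complex.conj_tsum]
    exact tsum_mul_tsum_of_summable_norm (hus x) (hws x)
  -- the double family is summable in norm, uniformly in `x`
  set N : ℕ × ℕ → ℝ := fun p ↦ (‖a p.1‖ * Real.exp (-(2 * π * p.1 * t))) *
    (‖b p.2‖ * Real.exp (-(2 * π * p.2 * t))) with hN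
  have hNs : Summable N := (summable_norm_mul_exp ha ht).mul_of_nonneg (summable_norm_mul_exp hb ht)
    (fun m ↦ by positivity) (fun m ↦ by positivity)
  have hnorm : ∀ p x, ‖u p.1 x * w p.2 x‖ = N p := fun p x ↦ by
    rw [norm_mul, hun, hwn]
  -- each term is continuous, hence integrable on `[0, 1]`
  have hcont : ∀ p : ℕ × ℕ, Continuous fun x : ℝ ↦ u p.1 x * w p.2 x := by
    intro p
    simp only [hu, hw]
    fun_prop
  -- termwise integrals: orthogonality
  have hterm : ∀ p : ℕ × ℕ, ∫ x in (0 : ℝ)..1, u p.1 x * w p.2 x =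
      if p.1 = p.2 then a p.1 * conj (b p.1) * ((Real.exp (-(4 * π * p.1 * t)) : ℝ) : ℂ) else 0 := by
    intro p
    have hre : ∀ x : ℝ, u p.1 x * w p.2 x = (a p.1 * conj (b p.2) *
        ((Real.exp (-(2 * π * p.1 * t)) : ℝ) : ℂ) * ((Real.exp (-(2 * π * p.2 * t)) : ℝ) : ℂ)) *
          Complex.exp (2 * π * Complex.I * ((p.1 : ℤ) - (p.2 : ℤ) : ℤ) * x) := by
      intro x
      simp only [hu, hw, map_mul, Complex.conj_ofReal, ← Complex.exp_conj, map_ofNat,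
        Complex.conj_I, map_natCast, Int.cast_sub, Int.cast_natCast]
      have hexp : Complex.exp (2 * π * Complex.I * ((p.1 : ℂ) - (p.2 : ℂ)) * x) =
          Complex.exp (2 * π * Complex.I * p.1 * x) * Complex.exp (2 * π * -Complex.I * p.2 * x) := by
        rw [← Complex.exp_add]
        congr 1
        ring
      rw [hexp]
      ring
    simp_rw [hre]
    rw [intervalIntegral.integral_const_mul, intervalIntegral_exp_two_pi_mul_I_int]
    by_cases hp : p.1 = p.2
    · rw [if_pos (by rw [hp]; ring), if_pos hp, mul_one, ← hp]
      rw [mul_assoc, ← Complex.ofReal_mul, ← Real.exp_add]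
      congr 3
      ring
    · rw [if_neg (by
        intro h
        exact hp (by exact_mod_cast (sub_eq_zero.mp h))), if_neg hp, mul_zero]
  -- interchange
  have hint : ∀ p : ℕ × ℕ, Integrable (fun x ↦ u p.1 x * w p.2 x)
      (volume.restrict (Set.Ioc (0 : ℝ) 1)) := fun p ↦
    (hcont p).integrableOn_Ioc
  have hsumint : Summable fun p : ℕ × ℕ ↦ ∫ x, ‖u p.1 x * w p.2 x‖
      ∂(volume.restrict (Set.Ioc (0 : ℝ) 1)) := by
    refine hNs.congr fun p ↦ ?_
    simp_rw [hnorm]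
    rw [MeasureTheory.integral_const]
    simp
  calc ∫ x in (0 : ℝ)..1, qSeries a ((x : ℂ) + t * Complex.I) * conj (qSeries b ((x : ℂ) + t * Complex.I))
      = ∫ x in (0 : ℝ)..1, ∑' p : ℕ × ℕ, u p.1 x * w p.2 x := by
        refine intervalIntegral.integral_congr fun x _ ↦ hprod x
    _ = ∑' p : ℕ × ℕ, ∫ x in (0 : ℝ)..1, u p.1 x * w p.2 x := by
        simp_rw [intervalIntegral.integral_of_le zero_le_one]
        exact (integral_tsum_of_summable_integral_norm hint hsumint).symm
    _ = ∑' p : ℕ × ℕ, (if p.1 = p.2 then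
          a p.1 * conj (b p.1) * ((Real.exp (-(4 * π * p.1 * t)) : ℝ) : ℂ) else 0) :=
        tsum_congr hterm
    _ = ∑' m : ℕ, a m * conj (b m) * ((Real.exp (-(4 * π * m * t)) : ℝ) : ℂ) := by
        refine (tsum_eq_tsum_of_ne_zero_bij (fun m : Function.support
          (fun m : ℕ ↦ a m * conj (b m) * ((Real.exp (-(4 * π * m * t)) : ℝ) : ℂ)) ↦
            ((m : ℕ), (m : ℕ))) ?_ ?_ ?_)
        · intro m m' h
          simp only [Prod.mk.injEq] at h
          exact Subtype.ext h.1
        · intro p hp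
          have hp' : p.1 = p.2 ∧ a p.1 * conj (b p.1) * ((Real.exp (-(4 * π * p.1 * t)) : ℝ) : ℂ) ≠ 0 := by
            by_cases h12 : p.1 = p.2
            · refine ⟨h12, ?_⟩
              simpa [Function.mem_support, h12] using hp
            · simp [Function.mem_support, h12] at hp
          refine ⟨⟨p.1, ?_⟩, ?_⟩
          · simp only [Function.mem_support, ne_eq]; exact hp'.2
          · simp only; exact Prod.ext rfl hp'.1
        · intro m
          simp

/-! ### The Mellin transform in `t`: the strip integral is a Dirichlet series -/

/-- `∑ ‖a(m)‖ ‖b(m)‖ e^{-4πmt} < ∞` (`t > 0`). [folklore] -/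
theorem summable_norm_mul_norm_mul_exp {a b : ℕ → ℂ} {Ca Cb : ℝ} {k : ℕ}
    (ha : ∀ m, ‖a m‖ ≤ Ca * ((m : ℝ) + 1) ^ k) (hb : ∀ m, ‖b m‖ ≤ Cb * ((m : ℝ) + 1) ^ k)
    {t : ℝ} (ht : 0 < t) :
    Summable fun m : ℕ ↦ ‖a m‖ * ‖b m‖ * Real.exp (-(4 * π * m * t)) := by
  have hbs := summable_norm_mul_exp hb ht
  set T : ℝ := ∑' m : ℕ, ‖b m‖ * Real.exp (-(2 * π * m * t)) with hT
  have hle : ∀ m : ℕ, ‖b m‖ * Real.exp (-(2 * π * m * t)) ≤ T := fun m ↦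
    hbs.le_tsum m fun j _ ↦ by positivity
  refine Summable.of_nonneg_of_le (fun m ↦ by positivity) (fun m ↦ ?_)
    ((summable_norm_mul_exp ha ht).mul_right T)
  have hsplit : Real.exp (-(4 * π * m * t)) =
      Real.exp (-(2 * π * m * t)) * Real.exp (-(2 * π * m * t)) := by
    rw [← Real.exp_add]; congr 1; ring
  rw [hsplit]
  calc ‖a m‖ * ‖b m‖ * (Real.exp (-(2 * π * m * t)) * Real.exp (-(2 * π * m * t)))
      = ‖a m‖ * Real.exp (-(2 * π * m * t)) * (‖b m‖ * Real.exp (-(2 * π * m * t))) := by ring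
    _ ≤ ‖a m‖ * Real.exp (-(2 * π * m * t)) * T :=
        mul_le_mul_of_nonneg_left (hle m) (by positivity)

/-- The `m`-th term of the Mellin transform: `∫₀^∞ e^{-rt} tˢ dt = Γ(s+1) r^{-(s+1)}` with
`r = 4π(m+1)`, times the coefficient. [folklore] -/
theorem integral_Ioi_exp_mul_cpow (c : ℂ) {r : ℝ} (hr : 0 < r) {s : ℂ} (hs : -1 < s.re) :
    ∫ t in Ioi (0 : ℝ), c * (((Real.exp (-(r * t)) : ℝ) : ℂ) * (t : ℂ) ^ s) =
      c * ((1 / (r : ℂ)) ^ (s + 1) * Complex.Gamma (s + 1)) := by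
  rw [MeasureTheory.integral_const_mul]
  congr 1
  have h := integral_cpow_mul_exp_neg_mul_Ioi (a := s + 1) (r := r)
    (by simp only [Complex.add_re, Complex.one_re]; linarith) hr
  rw [← h]
  refine setIntegral_congr_fun measurableSet_Ioi fun t _ ↦ ?_
  simp only [add_sub_cancel_right, Complex.ofReal_exp, mul_comm]
  congr 2
  push_cast
  ring

/-- Integrability of the `m`-th term on `(0, ∞)`. [folklore] -/
theorem integrableOn_exp_mul_cpow (c : ℂ) {r : ℝ} (hr : 0 < r) {s : ℂ} (hs : -1 < s.re) :
    IntegrableOn (fun t : ℝ ↦ c * (((Real.exp (-(r * t)) : ℝ) : ℂ) * (t : ℂ) ^ s)) (Ioi 0) := by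
  refine Integrable.const_mul ?_ c
  have hG : IntegrableOn (fun t : ℝ ↦ t ^ s.re * Real.exp (-r * t ^ (1 : ℝ))) (Ioi 0) :=
    integrableOn_rpow_mul_exp_neg_mul_rpow hs le_rfl hr
  refine Integrable.mono' hG ?_ ?_
  · refine Measurable.aestronglyMeasurable ?_
    exact (Complex.measurable_ofReal.comp (Real.measurable_exp.comp
      (measurable_const.mul measurable_id).neg)).mul (Complex.measurable_ofReal.pow_const s)
  · refine (ae_restrict_mem measurableSet_Ioi).mono fun t (ht : 0 < t) ↦ ?_
    rw [norm_mul, Complex.norm_real, Real.norm_of_nonneg (Real.exp_pos _).le,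
      Complex.norm_cpow_eq_rpow_re_of_pos ht, Real.rpow_one, mul_comm, neg_mul]

/-- The norm integral of the `m`-th term: `∫₀^∞ ‖c e^{-rt} tˢ‖ dt = ‖c‖ Γ(σ+1) r^{-(σ+1)}`. [folklore] -/
theorem integral_Ioi_norm_exp_mul_cpow (c : ℂ) {r : ℝ} (hr : 0 < r) {s : ℂ} (hs : -1 < s.re) :
    ∫ t in Ioi (0 : ℝ), ‖c * (((Real.exp (-(r * t)) : ℝ) : ℂ) * (t : ℂ) ^ s)‖ =
      ‖c‖ * ((1 / r) ^ (s.re + 1) * Real.Gamma (s.re + 1)) := by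
  have h := Real.integral_rpow_mul_exp_neg_mul_Ioi (a := s.re + 1) (r := r) (by linarith) hr
  rw [← h, ← MeasureTheory.integral_const_mul]
  refine setIntegral_congr_fun measurableSet_Ioi fun t (ht : 0 < t) ↦ ?_
  rw [norm_mul, norm_mul, Complex.norm_real, Real.norm_of_nonneg (Real.exp_pos _).le,
    Complex.norm_cpow_eq_rpow_re_of_pos ht, add_sub_cancel_right]
  ring

/-- Summability of the termwise norm integrals for `Re s > 2k`. [folklore] -/
theorem summable_norm_coeff_mul_rpow {a b : ℕ → ℂ} {Ca Cb : ℝ} {k : ℕ}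
    (ha : ∀ m, ‖a m‖ ≤ Ca * ((m : ℝ) + 1) ^ k) (hb : ∀ m, ‖b m‖ ≤ Cb * ((m : ℝ) + 1) ^ k)
    {σ : ℝ} (hσ : 2 * k < σ) :
    Summable fun m : ℕ ↦ ‖a (m + 1) * conj (b (m + 1))‖ *
      ((1 / (4 * π * ((m : ℝ) + 1))) ^ (σ + 1) * Real.Gamma (σ + 1)) := by
  have hCa : 0 ≤ Ca := by
    have := ha 0; simp at this; exact (norm_nonneg _).trans this
  have hCb : 0 ≤ Cb := by
    have := hb 0; simp at this; exact (norm_nonneg _).trans this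
  -- comparison series `K (m+1)^{2k-σ-1}`
  set q : ℝ := 2 * k - σ - 1 with hq
  have hq1 : q < -1 := by rw [hq]; linarith
  have hbase : Summable fun m : ℕ ↦ (((m + 1 : ℕ) : ℝ)) ^ q :=
    (summable_nat_add_iff 1).mpr (Real.summable_nat_rpow.mpr hq1)
  set K : ℝ := Ca * Cb * 2 ^ (2 * k) * ((1 / (4 * π)) ^ (σ + 1) * Real.Gamma (σ + 1)) with hK
  have hΓ : 0 < Real.Gamma (σ + 1) := Real.Gamma_pos_of_pos (by
    have : (0 : ℝ) ≤ 2 * k := by positivity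
    linarith)
  have hK0 : 0 ≤ K := by positivity
  refine Summable.of_nonneg_of_le (fun m ↦ by positivity) (fun m ↦ ?_) (hbase.mul_left K)
  have hm1 : (0 : ℝ) < (m : ℝ) + 1 := by positivity
  -- the coefficient bound
  have hc : ‖a (m + 1) * conj (b (m + 1))‖ ≤ Ca * Cb * 2 ^ (2 * k) * ((m : ℝ) + 1) ^ ((2 * k : ℕ) : ℝ) := by
    rw [norm_mul, Complex.norm_conj, Real.rpow_natCast]
    have h1 := ha (m + 1)
    have h2 := hb (m + 1)
    push_cast at h1 h2
    have h3 : ((m : ℝ) + 1 + 1) ^ k ≤ (2 * ((m : ℝ) + 1)) ^ k :=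
      pow_le_pow_left₀ (by positivity) (by linarith) k
    calc ‖a (m + 1)‖ * ‖b (m + 1)‖ ≤ (Ca * ((m : ℝ) + 1 + 1) ^ k) * (Cb * ((m : ℝ) + 1 + 1) ^ k) :=
          mul_le_mul h1 h2 (norm_nonneg _) ((norm_nonneg _).trans h1)
      _ ≤ (Ca * (2 * ((m : ℝ) + 1)) ^ k) * (Cb * (2 * ((m : ℝ) + 1)) ^ k) :=
          mul_le_mul (mul_le_mul_of_nonneg_left h3 hCa) (mul_le_mul_of_nonneg_left h3 hCb)
            (by positivity) (by positivity)
      _ = Ca * Cb * 2 ^ (2 * k) * ((m : ℝ) + 1) ^ (2 * k) := by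
          rw [mul_pow, show 2 * k = k + k from two_mul k, pow_add, pow_add]; ring
  -- the power of `1/(4π(m+1))`
  have hpow : (1 / (4 * π * ((m : ℝ) + 1))) ^ (σ + 1) =
      (1 / (4 * π)) ^ (σ + 1) * ((m : ℝ) + 1) ^ (-(σ + 1)) := by
    rw [show 1 / (4 * π * ((m : ℝ) + 1)) = (1 / (4 * π)) * ((m : ℝ) + 1)⁻¹ by
      field_simp, Real.mul_rpow (by positivity) (by positivity), Real.rpow_neg hm1.le,
      Real.inv_rpow hm1.le]
  rw [hpow]
  have hcomb : ((m : ℝ) + 1) ^ ((2 * k : ℕ) : ℝ) * ((m : ℝ) + 1) ^ (-(σ + 1)) =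
      (((m + 1 : ℕ) : ℝ)) ^ q := by
    rw [← Real.rpow_add hm1]; push_cast; congr 1; rw [hq]; ring
  calc ‖a (m + 1) * conj (b (m + 1))‖ *
        ((1 / (4 * π)) ^ (σ + 1) * ((m : ℝ) + 1) ^ (-(σ + 1)) * Real.Gamma (σ + 1))
      ≤ (Ca * Cb * 2 ^ (2 * k) * ((m : ℝ) + 1) ^ ((2 * k : ℕ) : ℝ)) *
        ((1 / (4 * π)) ^ (σ + 1) * ((m : ℝ) + 1) ^ (-(σ + 1)) * Real.Gamma (σ + 1)) :=
        mul_le_mul_of_nonneg_right hc (by positivity)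
    _ = K * ((((m + 1 : ℕ) : ℝ)) ^ q) := by rw [← hcomb, hK]; ring

/-- Dropping a vanishing first term: `∑_m f(m) = ∑_m f(m+1)` if `f(0) = 0`. [folklore] -/
theorem tsum_eq_tsum_succ_of_zero {f : ℕ → ℂ} (hf : Summable f) (h0 : f 0 = 0) :
    ∑' m : ℕ, f m = ∑' m : ℕ, f (m + 1) := by
  rw [hf.tsum_eq_zero_add, h0, zero_add]

/-- The integrand of the Mellin transform on `t > 0` as a series over `m ≥ 1`. [folklore] -/
theorem horizontal_mul_cpow_eq_tsum {a b : ℕ → ℂ} {Ca Cb : ℝ} {k : ℕ}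
    (ha : ∀ m, ‖a m‖ ≤ Ca * ((m : ℝ) + 1) ^ k) (hb : ∀ m, ‖b m‖ ≤ Cb * ((m : ℝ) + 1) ^ k)
    (ha0 : a 0 = 0) (s : ℂ) {t : ℝ} (ht : 0 < t) :
    (∫ x in (0 : ℝ)..1, qSeries a ((x : ℂ) + t * Complex.I) *
        conj (qSeries b ((x : ℂ) + t * Complex.I))) * (t : ℂ) ^ s =
      ∑' m : ℕ, (a (m + 1) * conj (b (m + 1))) *
        (((Real.exp (-((4 * π * ((m : ℝ) + 1)) * t)) : ℝ) : ℂ) * (t : ℂ) ^ s) := by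
  rw [intervalIntegral_qSeries_mul_conj ha hb ht, ← tsum_mul_right]
  have hnorm : ∀ m : ℕ, ‖a m * conj (b m) * ((Real.exp (-(4 * π * m * t)) : ℝ) : ℂ)‖ =
      ‖a m‖ * ‖b m‖ * Real.exp (-(4 * π * m * t)) := by
    intro m
    rw [norm_mul, norm_mul, Complex.norm_conj, Complex.norm_real, Real.norm_eq_abs,
      abs_of_pos (Real.exp_pos _)]
  have hsum0 : Summable fun m : ℕ ↦ a m * conj (b m) * ((Real.exp (-(4 * π * m * t)) : ℝ) : ℂ) := by
    refine Summable.of_norm ?_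
    simp_rw [hnorm]
    exact summable_norm_mul_norm_mul_exp ha hb ht
  have hsum : Summable fun m : ℕ ↦ a m * conj (b m) * ((Real.exp (-(4 * π * m * t)) : ℝ) : ℂ) *
      (t : ℂ) ^ s := hsum0.mul_right _
  rw [tsum_eq_tsum_succ_of_zero hsum (by rw [ha0, zero_mul, zero_mul, zero_mul])]
  refine tsum_congr fun m ↦ ?_
  have hcast : (-(4 * π * ((m + 1 : ℕ) : ℝ) * t) : ℝ) = -((4 * π * ((m : ℝ) + 1)) * t) := by
    push_cast; ring
  rw [hcast]
  ring

set_option maxHeartbeats 400000 in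
/-- **The strip integral is a Dirichlet series**: for `Re s > 2k` and `a(0) = 0`,
`∫₀^∞ (∫₀¹ φ(x + it) conj(F(x + it)) dx) tˢ dt = Γ(s+1) ∑_{m ≥ 1} a(m) conj(b(m)) (4πm)^{-(s+1)}`.
[folklore] -/
theorem integral_Ioi_qSeries_mul_conj_mul_cpow {a b : ℕ → ℂ} {Ca Cb : ℝ} {k : ℕ}
    (ha : ∀ m, ‖a m‖ ≤ Ca * ((m : ℝ) + 1) ^ k) (hb : ∀ m, ‖b m‖ ≤ Cb * ((m : ℝ) + 1) ^ k)
    (ha0 : a 0 = 0) {s : ℂ} (hs : 2 * k < s.re) :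
    ∫ t in Ioi (0 : ℝ), (∫ x in (0 : ℝ)..1, qSeries a ((x : ℂ) + t * Complex.I) *
        conj (qSeries b ((x : ℂ) + t * Complex.I))) * (t : ℂ) ^ s =
      Complex.Gamma (s + 1) * ∑' m : ℕ, a (m + 1) * conj (b (m + 1)) *
        (1 / ((4 * π * ((m : ℝ) + 1) : ℝ) : ℂ)) ^ (s + 1) := by
  have hs1 : -1 < s.re := by
    have : (0 : ℝ) ≤ 2 * k := by positivity
    linarith
  set F : ℕ → ℝ → ℂ := fun m t ↦ (a (m + 1) * conj (b (m + 1))) *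
    (((Real.exp (-((4 * π * ((m : ℝ) + 1)) * t)) : ℝ) : ℂ) * (t : ℂ) ^ s) with hF
  -- Step 1: on `t > 0` the integrand is `∑ F m t`
  have h1 : EqOn (fun t : ℝ ↦ (∫ x in (0 : ℝ)..1, qSeries a ((x : ℂ) + t * Complex.I) *
      conj (qSeries b ((x : ℂ) + t * Complex.I))) * (t : ℂ) ^ s) (fun t ↦ ∑' m : ℕ, F m t) (Ioi 0) :=
    fun t ht ↦ horizontal_mul_cpow_eq_tsum ha hb ha0 s ht
  rw [setIntegral_congr_fun measurableSet_Ioi h1]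
  -- Step 2: interchange
  have hint : ∀ m : ℕ, Integrable (F m) (volume.restrict (Ioi (0 : ℝ))) := fun m ↦
    integrableOn_exp_mul_cpow _ (by positivity) hs1
  have hsumint : Summable fun m : ℕ ↦ ∫ t, ‖F m t‖ ∂(volume.restrict (Ioi (0 : ℝ))) := by
    refine (summable_norm_coeff_mul_rpow ha hb hs).congr fun m ↦ ?_
    exact (integral_Ioi_norm_exp_mul_cpow _ (by positivity) hs1).symm
  rw [← integral_tsum_of_summable_integral_norm hint hsumint]
  -- Step 3: termwise Gamma integrals
  have hterm : ∀ m : ℕ, ∫ t in Ioi (0 : ℝ), F m t = a (m + 1) * conj (b (m + 1)) *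
      ((1 / ((4 * π * ((m : ℝ) + 1) : ℝ) : ℂ)) ^ (s + 1) * Complex.Gamma (s + 1)) := fun m ↦
    integral_Ioi_exp_mul_cpow _ (by positivity) hs1
  rw [tsum_congr hterm, ← tsum_mul_left]
  refine tsum_congr fun m ↦ ?_
  ring

end Literature.NumberTheory.EllipticCurves.ModularForms
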